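import Literature.NumberTheory.GaloisRepresentations.PrimaryGeneratorHeckeCharacter
import Literature.NumberTheory.GaloisRepresentations.CMTypeHeckeCharacter
import Mathlib.NumberTheory.MulChar.Basic
import Mathlib.NumberTheory.NumberField.InfinitePlace.TotallyRealComplex
import HarnessLib

/-!
# The Größencharakter `(α) ↦ e(α)·ε(ᾱ)⁻¹` of a principal ideal domain, and the values of `heckeOfGross`
# on the local units at the primes of the modulus

Topic `NumberTheory/GaloisRepresentations`; namespace `Literature.NumberTheory.GaloisRepresentations`.
Everything here is **proved**; there is no named fact. Sequel of `PrimaryGeneratorHeckeCharacter.lean` (the case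
"every residue class prime to `𝔣` contains exactly one unit": `χ((α)) = e(α)` for `α` primary) and of
`HeckeCharacterOfGrossencharakter.lean` (`heckeOfGross`).

* §1 `charNormValue e ε` (`Φ(x) = e(x) · ε(x mod 𝔣)⁻¹` for an embedding `e : K → ℂ` and a multiplicative character
  `ε` of `𝓞 K ⧸ 𝔣` — a monoid hom `𝓞 K →* ℂ`) and `charGenValue e ε v = Φ(g_v)` (`g_v` Mathlib's generator of the
  prime `𝔭_v` of the PID `𝓞 K`); **`isGrossencharakter_charGenValue`** — if `ε(u) = e(u)` for every global unit `u`
  then `v ↦ Φ(g_v)` is a Größencharakter `mod 𝔣` of infinity type `(embType e, embTypeConj e)`, i.e.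
  `χ̃((b)) = e(b) ε(b̄)⁻¹` for `b` prime to `𝔣` (Ireland–Rosen Ch. 18 §4–§7: the CM characters "`χ((α)) = ε(α)⁻¹ α`",
  e.g. `ψ((α)) = (α/√−7)₂ α` of `X₀(49)`; Rajwade 1977; Gross, LNM 776 §8); `exists_heckeCharacter_charGenValue`.
* §2 **`heckeOfGross_localUnits_mul_idealPow`** — for ANY Größencharakter `ψ mod 𝔣` of type `(p, q)` over a totally
  complex `K`, a prime `w ∣ 𝔣` and an integer `a ∉ w`, prime to `𝔣`, with `a ≡ 1 mod 𝔭_v^{n_v}` at the other primes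
  `𝔭_v ∣ 𝔣`: `ω(⟨a⟩_w) · χ̃((a)) = ∏_{w'} σ_{w'}(a)^{p} σ̄_{w'}(a)^{q}`, where `⟨a⟩_w` is the local idele with `a` at `w`
  (Tate, Cassels–Fröhlich VII §4: `ω((a)) = 1` and `(a) = (a)_∞ · ⟨a⟩_w · y` with `y` in the congruence subgroup
  off `w`); hence **`not_isUnramifiedAt_heckeOfGross_of_ne`**: if `χ̃((a)) ≠ ∏ σ(a)^p σ̄(a)^q` for one such `a`, `ω` is
  RAMIFIED at `w`; for `Φ` this reads `ε(ā) ≠ 1` (`not_isUnramifiedAt_heckeOfGross_charGenValue`).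

Consumer: the «Deuring-ψ lane» of route `BiquadraticEisensteinDescent` (`Summits/BirchSwinnertonDyer`): the
Grössencharacter of a CM elliptic curve over `ℚ` with CM by a maximal order of class number one, e.g.
`K = ℚ(√−7)`, `𝔣 = (√−7)`, `ε` the Legendre symbol of `𝓞 K/(√−7) ≅ 𝔽₇`.

## References
* K. Ireland, M. Rosen, *A Classical Introduction to Modern Number Theory* (1982/1990), Ch. 18 §4, §6 (proof of
  Theorem 7), §7. [IrelandRosen1982]
* A. R. Rajwade, *The Diophantine equation …* / *Some formulae for elliptic curves with complex multiplication*,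
  Indian J. Pure Appl. Math. 8 (1977), Thm. 4. [Rajwade1977]
* J. W. S. Cassels, A. Fröhlich (eds.), *Algebraic Number Theory* (1967), Ch. VII (Tate) §4 Prop. 4.1.
  [CasselsFrohlichANT1967]
* J. Neukirch, *Algebraic Number Theory* (1999), Ch. VII §6 (6.13)–(6.14). [NeukirchANT1999]
-/

noncomputable section

open NumberField IsDedekindDomain IsDedekindDomain.HeightOneSpectrum
open scoped ComplexConjugate

namespace Literature.NumberTheory.GaloisRepresentations

variable {K : Type} [Field K] [NumberField K]

/-! ### §1 The Größencharakter `(α) ↦ e(α) ε(ᾱ)⁻¹` -/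

section Construction

variable {𝔣 : Ideal (𝓞 K)}

/-- **The normalised value `Φ(x) = e(x) · ε(x mod 𝔣)⁻¹`** of an integer `x`, for an embedding `e : K → ℂ` and a
multiplicative character `ε` of `𝓞 K ⧸ 𝔣` (zero off the units): a monoid hom `𝓞 K →* ℂ`, vanishing exactly on the
integers not prime to `𝔣`. (Ireland–Rosen Ch. 18 §7: `χ(α) = ε(α)⁻¹ α`.) [cite: IrelandRosen1982, Ch. 18 §7] -/
def charNormValue (e : K →+* ℂ) (ε : MulChar (𝓞 K ⧸ 𝔣) ℂ) : 𝓞 K →* ℂ where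
  toFun x := e.comp (algebraMap (𝓞 K) K) x * (ε (Ideal.Quotient.mk 𝔣 x))⁻¹
  map_one' := by rw [map_one, map_one, map_one, inv_one, mul_one]
  map_mul' x y := by rw [map_mul, map_mul, map_mul, mul_inv, mul_mul_mul_comm]

omit [NumberField K] in
/-- Unfolding `charNormValue`. [cite: IrelandRosen1982, Ch. 18 §7] -/
theorem charNormValue_apply (e : K →+* ℂ) (ε : MulChar (𝓞 K ⧸ 𝔣) ℂ) (x : 𝓞 K) :
    charNormValue e ε x = e x * (ε (Ideal.Quotient.mk 𝔣 x))⁻¹ := rfl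

omit [NumberField K] in
/-- `Φ(u) = 1` for a global unit `u` when `ε(ū) = e(u)`. [cite: IrelandRosen1982, Ch. 18 §7] -/
theorem charNormValue_units (e : K →+* ℂ) (ε : MulChar (𝓞 K ⧸ 𝔣) ℂ)
    (hε : ∀ u : (𝓞 K)ˣ, ε (Ideal.Quotient.mk 𝔣 u) = e ((u : 𝓞 K) : K)) (u : (𝓞 K)ˣ) :
    charNormValue e ε u = 1 := by
  rw [charNormValue_apply, hε u, mul_inv_cancel₀]
  exact (map_ne_zero e).mpr (by exact_mod_cast u.ne_zero)

omit [NumberField K] in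
/-- An integer generating an ideal prime to `𝔣` is a unit modulo `𝔣` (Neukirch I (3.6), CRT). [cite: NeukirchANT1999, Ch. I §3 (3.6)] -/
theorem isUnit_mk_of_isCoprime_span {x : 𝓞 K} (h : IsCoprime (Ideal.span {x}) 𝔣) :
    IsUnit (Ideal.Quotient.mk 𝔣 x) := by
  obtain ⟨a, ha, b, hb, hab⟩ := Ideal.isCoprime_iff_exists.mp h
  obtain ⟨r, rfl⟩ := Ideal.mem_span_singleton'.mp ha
  refine IsUnit.of_mul_eq_one (Ideal.Quotient.mk 𝔣 r) ?_
  rw [← map_mul, mul_comm, ← (Ideal.Quotient.eq (I := 𝔣)).mpr]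
  · exact map_one _
  · rw [← hab]; simpa using hb

omit [NumberField K] in
/-- `Φ(x) ≠ 0` for `x ≠ 0` prime to `𝔣`. [cite: IrelandRosen1982, Ch. 18 §7] -/
theorem charNormValue_ne_zero (e : K →+* ℂ) (ε : MulChar (𝓞 K ⧸ 𝔣) ℂ) {x : 𝓞 K} (hx : x ≠ 0)
    (hcop : IsCoprime (Ideal.span {x}) 𝔣) : charNormValue e ε x ≠ 0 := by
  rw [charNormValue_apply]
  refine mul_ne_zero ((map_ne_zero e).mpr (by exact_mod_cast hx)) (inv_ne_zero ?_)
  obtain ⟨u, hu⟩ := isUnit_mk_of_isCoprime_span hcop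
  rw [← hu, ← MulChar.coe_toUnitHom]
  exact Units.ne_zero _

variable [IsPrincipalIdealRing (𝓞 K)]

/-- **`Φ(g_v)`**, `g_v` Mathlib's generator of the prime `𝔭_v` of the PID `𝓞 K`: the value at `𝔭_v ∤ 𝔣` of the
Größencharakter `(α) ↦ e(α) ε(ᾱ)⁻¹` (independent of the generator: `Φ` kills the units). [cite: IrelandRosen1982, Ch. 18 §7] -/
def charGenValue (e : K →+* ℂ) (ε : MulChar (𝓞 K ⧸ 𝔣) ℂ) (v : HeightOneSpectrum (𝓞 K)) : ℂ :=
  charNormValue e ε (Submodule.IsPrincipal.generator v.asIdeal)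

/-- **`χ̃((b)) = Φ(b)`**: for a nonzero integer `b` prime to `𝔣`, `∏_v Φ(g_v)^{ν_v((b))} = e(b) ε(b̄)⁻¹`
(`(b) = ∏ 𝔭_v^{ν_v}`, so `∏ g_v^{ν_v} = b u` for a unit `u`, and `Φ(u) = 1`). [cite: IrelandRosen1982, Ch. 18 §7] -/
theorem idealPow_charGenValue_span (e : K →+* ℂ) (ε : MulChar (𝓞 K ⧸ 𝔣) ℂ)
    (hε : ∀ u : (𝓞 K)ˣ, ε (Ideal.Quotient.mk 𝔣 u) = e ((u : 𝓞 K) : K)) {b : 𝓞 K} (hb : b ≠ 0) :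
    LFunctions.idealPow K (charGenValue e ε) (Ideal.span {b}) = charNormValue e ε b := by
  classical
  set I : Ideal (𝓞 K) := Ideal.span {b} with hI
  have hI0 : I ≠ ⊥ := (Submodule.ne_bot_iff _).mpr ⟨b, Ideal.mem_span_singleton_self b, hb⟩
  set c : HeightOneSpectrum (𝓞 K) → ℕ := fun v => (Associates.mk v.asIdeal).count (Associates.mk I).factors with hc
  set g : HeightOneSpectrum (𝓞 K) → 𝓞 K := fun v => Submodule.IsPrincipal.generator v.asIdeal with hg
  have hfin : (Function.mulSupport fun v : HeightOneSpectrum (𝓞 K) => g v ^ c v).Finite := by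
    refine (Ideal.finite_factors hI0).subset fun v hv => ?_
    rw [Function.mem_mulSupport] at hv
    rw [Set.mem_setOf_eq, ← Associates.count_ne_zero_iff_dvd hI0 v.irreducible]
    intro h0; exact hv (by simp only [hc] at h0 ⊢; rw [h0, pow_zero])
  -- the span of `∏ g_v^{c_v}` is `(b)`
  let σ : 𝓞 K →* Ideal (𝓞 K) :=
    { toFun := fun x => Ideal.span {x}
      map_one' := by rw [Ideal.span_singleton_one, Ideal.one_eq_top]
      map_mul' := fun x y => (Ideal.span_singleton_mul_span_singleton x y).symm }
  have hspan : Ideal.span {∏ᶠ v : HeightOneSpectrum (𝓞 K), g v ^ c v} = I := by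
    change σ _ = I
    rw [σ.map_finprod hfin, ← Ideal.finprod_heightOneSpectrum_factorization hI0]
    refine finprod_congr fun v => ?_
    change Ideal.span {g v ^ c v} = v.asIdeal ^ c v
    rw [← Ideal.span_singleton_pow, hg, Ideal.span_singleton_generator]
  -- hence `∏ g_v^{c_v} = b · u`
  obtain ⟨u, hu⟩ : Associated (∏ᶠ v : HeightOneSpectrum (𝓞 K), g v ^ c v) b :=
    Ideal.span_singleton_eq_span_singleton.mp hspan
  -- `χ̃((b)) = Φ(∏ g_v^{c_v})`
  have hpow : LFunctions.idealPow K (charGenValue e ε) I =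
      charNormValue e ε (∏ᶠ v : HeightOneSpectrum (𝓞 K), g v ^ c v) := by
    rw [LFunctions.idealPow, MonoidHom.map_finprod _ hfin]
    exact finprod_congr fun v => by rw [map_pow]; rfl
  rw [hpow, ← hu, map_mul, charNormValue_units e ε hε u, mul_one]

/-- **`(α) ↦ e(α) ε(ᾱ)⁻¹` is a Größencharakter `mod 𝔣` of infinity type `(embType e, embTypeConj e)`** when
`ε(u) = e(u)` on the global units: `χ̃((b)) = e(b) ε(b̄)⁻¹`, and for `b ≡ c mod 𝔣` prime to `𝔣`,
`χ̃((b))/χ̃((c)) = e(b/c)`. (Ireland–Rosen Ch. 18 §7; the character `ψ((λ)) = (λ/√−7)₂ λ` of Rajwade.)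
[cite: IrelandRosen1982, Ch. 18 §7] [cite: Rajwade1977, Thm. 4] -/
theorem isGrossencharakter_charGenValue (e : K →+* ℂ) (ε : MulChar (𝓞 K ⧸ 𝔣) ℂ)
    (hε : ∀ u : (𝓞 K)ˣ, ε (Ideal.Quotient.mk 𝔣 u) = e ((u : 𝓞 K) : K)) :
    IsGrossencharakter 𝔣 (embType e) (embTypeConj e) (charGenValue e ε) := by
  refine ⟨fun v hv => ?_, fun b c hb hc hcop hbc _ => ?_⟩
  · exact charNormValue_ne_zero e ε
      (fun h => v.ne_bot (by rw [← Ideal.span_singleton_generator v.asIdeal, h, Ideal.span_singleton_eq_bot]))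
      (isCoprime_span_generator hv)
  · have hbcop : IsCoprime (Ideal.span {b}) 𝔣 := LFunctions.isCoprime_span_of_sub_mem hcop hbc
    rw [idealPow_charGenValue_span e ε hε hb, idealPow_charGenValue_span e ε hε hc, prod_embedding_zpow_embType,
      charNormValue_apply, charNormValue_apply, (Ideal.Quotient.eq (I := 𝔣)).mpr hbc, map_div₀]
    have hc' : (e c : ℂ) ≠ 0 := (map_ne_zero e).mpr fun h => hc (by exact_mod_cast h)
    field_simp

/-- **The algebraic Hecke character `ω` of `(α) ↦ e(α) ε(ᾱ)⁻¹`**: for `𝔣 ≠ 0` there is a Hecke character of `K`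
of infinity type `(embType e, embTypeConj e)`, unramified at every `𝔭_v ∤ 𝔣` with `ω(ϖ_v) = e(g_v) ε(ḡ_v)⁻¹`
(`heckeOfGross`; Weil 1956 §1 / Neukirch VII (6.14)). [cite: IrelandRosen1982, Ch. 18 §7] [cite: Weil1956, §1] -/
theorem exists_heckeCharacter_charGenValue (h𝔣 : 𝔣 ≠ ⊥) (e : K →+* ℂ) (ε : MulChar (𝓞 K ⧸ 𝔣) ℂ)
    (hε : ∀ u : (𝓞 K)ˣ, ε (Ideal.Quotient.mk 𝔣 u) = e ((u : 𝓞 K) : K)) :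
    ∃ ω : HeckeCharacter K, ω.HasInfinityType (embType e) (embTypeConj e) ∧
      ∀ v : HeightOneSpectrum (𝓞 K), ¬ 𝔣 ≤ v.asIdeal →
        ω.IsUnramifiedAt v ∧ ω.valueAtUniformizer v = charGenValue e ε v :=
  HeckeCharacter.exists_of_isGrossencharakter h𝔣 (isGrossencharakter_charGenValue e ε hε)

end Construction

/-! ### §1b The infinity type at the place of `e` when it is the only infinite place -/

omit [NumberField K] in
/-- If every infinite place has chosen embedding `e` (e.g. `K` imaginary quadratic and `e = σ_{w₀}`), the type
`(embType e, embTypeConj e)` is `(1, 0)` (Weil's type `A₀` as an element of `ℤ[Hom(K, ℂ)]`). [cite: Weil1956, §1] -/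
theorem embType_eq_one_of_forall {e : K →+* ℂ} (he : ∀ w : InfinitePlace K, w.embedding = e) :
    embType e = (fun _ => 1) ∧ embTypeConj e = (fun _ => 0) := by
  constructor
  · funext w; rw [embType, if_pos (he w)]
  · funext w; rw [embTypeConj, if_pos (he w)]

/-! ### §2 The values of `heckeOfGross` on the local units at a prime of the modulus -/

section LocalUnits

variable {𝔣 : Ideal (𝓞 K)} {p q : InfinitePlace K → ℤ} {ψ : HeightOneSpectrum (𝓞 K) → ℂ}

/-- The inverse of `ω₀` (multiplicativity). [cite: CasselsFrohlichANT1967, Ch. VII §4 Prop. 4.1 (proof)] -/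
theorem grossIdeleValue_inv (hψ : IsGrossencharakter 𝔣 p q ψ) (x : ideleGroup K) :
    grossIdeleValue hψ x⁻¹ = (grossIdeleValue hψ x)⁻¹ := by
  refine eq_inv_of_mul_eq_one_right ?_
  rw [← grossIdeleValue_mul, mul_inv_cancel, grossIdeleValue_one]

/-- `χ̃((a))` is the `ω₀`-finite part of the principal idele of a nonzero INTEGER `a` prime to `𝔣` (Neukirch VI (1.9): `(a) = ∏ 𝔭^{v_𝔭(a)}`). [cite: NeukirchANT1999, Ch. VI §1 Prop. (1.9)] -/
theorem coe_grossFinValue_principalIdele (h𝔣 : 𝔣 ≠ ⊥) (hψ : IsGrossencharakter 𝔣 p q ψ) {a : 𝓞 K}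
    (ha0 : a ≠ 0) (hcop : IsCoprime (Ideal.span {a}) 𝔣) (haK : (a : K) ≠ 0) :
    ((grossFinValue hψ (principalIdele K (Units.mk0 (a : K) haK)) : ℂˣ) : ℂ) =
      LFunctions.idealPow K ψ (Ideal.span {a}) := by
  rw [← coe_finprod_grossUnitValue_pow_count h𝔣 hψ ha0 hcop]
  unfold grossFinValue
  congr 1
  refine finprod_congr fun v => ?_
  rw [ideleOrd_principalIdele, Units.val_mk0, valuation_coe_eq_exp_neg_count v ha0, WithZero.log_exp, neg_neg]

/-- **The value of `ω = heckeOfGross` on a local unit at a prime of the modulus.** Let `ψ` be a Größencharakter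
`mod 𝔣` of type `(p, q)` over a totally complex `K`, `w` a prime with `𝔣 ⊆ 𝔭_w`, and `a ∈ 𝓞 K` an integer prime to
`𝔣` (so `a ∉ 𝔭_w`) with `a ≡ 1 mod 𝔭_v^{n_v}` at every OTHER prime `𝔭_v ∣ 𝔣`. Then for the local idele `⟨a⟩_w`:
`ω(⟨a⟩_w) · χ̃((a)) = ∏_{w'} σ_{w'}(a)^{p_{w'}} σ̄_{w'}(a)^{q_{w'}}` — because `y = (a)·⟨a⟩_w⁻¹` lies in the congruence
subgroup, where `ω = ω₀ = χ̃((·)) · A_{p,q}`, and `ω((a)) = 1`. (Tate, Cassels–Fröhlich VII §4 Prop. 4.1; this is how the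
conductor of an algebraic Hecke character is read off its ideal character.) [cite: CasselsFrohlichANT1967, Ch. VII §4 Prop. 4.1]
[cite: NeukirchANT1999, Ch. VII §6 Prop. (6.13)] -/
theorem heckeOfGross_localUnits_mul_idealPow [IsTotallyComplex K] (h𝔣 : 𝔣 ≠ ⊥) (hψ : IsGrossencharakter 𝔣 p q ψ)
    {w : HeightOneSpectrum (𝓞 K)} (hw : 𝔣 ≤ w.asIdeal) {a : 𝓞 K} (hcop : IsCoprime (Ideal.span {a}) 𝔣)
    (hcong : ∀ v : HeightOneSpectrum (𝓞 K), v ≠ w → modulusExp 𝔣 v ≠ 0 → a - 1 ∈ v.asIdeal ^ modulusExp 𝔣 v)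
    (haw : (algebraMap K (w.adicCompletion K) (a : K)) ≠ 0) :
    ((heckeOfGross h𝔣 hψ (localUnits w (Units.mk0 _ haw)) : ℂˣ) : ℂ) * LFunctions.idealPow K ψ (Ideal.span {a}) =
      ∏ w' : InfinitePlace K, w'.embedding (a : K) ^ p w' * conj (w'.embedding (a : K)) ^ q w' := by
  have haK : (a : K) ≠ 0 := fun h => haw (by rw [h, map_zero])
  have ha0 : a ≠ 0 := fun h => haK (by rw [h]; rfl)
  set k : Kˣ := Units.mk0 (a : K) haK with hk
  set u : (w.adicCompletion K)ˣ := Units.mk0 _ haw with hu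
  set y : ideleGroup K := principalIdele K k * (localUnits w u)⁻¹ with hy
  -- `y` lies in the congruence subgroup
  have hymem : y ∈ congruenceIdeles 𝔣 := by
    refine ⟨fun v hv => ?_, fun w' hw' => absurd hw' ?_⟩
    · rw [hy, ideleGroup_val_snd_mul, ideleGroup_val_inv_snd, principalIdele_snd]
      by_cases hvw : v = w
      · subst hvw
        rw [localUnits_snd_apply_self]
        have e0 : algebraMap K (v.adicCompletion K) (k : K) * ((u : (v.adicCompletion K)ˣ) : v.adicCompletion K)⁻¹
            = 1 := by
          rw [hu, Units.val_mk0]; exact mul_inv_cancel₀ haw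
        rw [e0, sub_self, map_zero]
        exact zero_le
      · rw [localUnits_snd_apply_of_ne u hvw, inv_one, mul_one]
        have e1 : algebraMap K (v.adicCompletion K) (k : K) - 1 =
            algebraMap K (v.adicCompletion K) (algebraMap (𝓞 K) K (a - 1)) := by
          rw [map_sub (algebraMap (𝓞 K) K), map_one, map_sub, map_one]; rfl
        rw [e1, valued_algebraMap_adicCompletion, valuation_of_algebraMap]
        exact (v.intValuation_le_pow_iff_mem (a - 1) (modulusExp 𝔣 v)).mpr (hcong v hvw hv)
    · exact InfinitePlace.not_isReal_iff_isComplex.mpr (IsTotallyComplex.isComplex w')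
  -- `ω(y) = ω₀(y)` and `ω(y) = ω(⟨a⟩_w)⁻¹`
  have h1 : heckeOfGross h𝔣 hψ y = (heckeOfGross h𝔣 hψ (localUnits w u))⁻¹ := by
    rw [hy, map_mul, map_inv, (heckeOfGross h𝔣 hψ).map_principal (principalIdele_mem k), one_mul]
  have h2 : heckeOfGross h𝔣 hψ y = grossIdeleValue hψ y := heckeOfGross_apply_of_mem h𝔣 hψ hymem
  -- `ω₀(y) = χ̃((a)) · A_{p,q}((a)_∞)`
  have h3 : grossIdeleValue hψ (localUnits w u) = 1 := by
    rw [grossIdeleValue_localUnits, grossUnitValue_of_le hψ hw, one_zpow]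
  have h4 : ((grossIdeleValue hψ y : ℂˣ) : ℂ) =
      LFunctions.idealPow K ψ (Ideal.span {a}) * HeckeCharacter.archFactor p q (globalToInfiniteUnits K k) := by
    rw [hy, grossIdeleValue_mul, grossIdeleValue_inv, h3, inv_one, mul_one, grossIdeleValue_def, Units.val_mul,
      coe_grossFinValue_principalIdele h𝔣 hψ ha0 hcop haK, HeckeCharacter.coe_archIdeleChar_apply,
      HeckeCharacter.infPart_principalIdele]
  have h5 := archFactor_globalToInfiniteUnits_mul_prod p q k
  -- assemble
  have hX : ((heckeOfGross h𝔣 hψ (localUnits w u) : ℂˣ) : ℂ) ≠ 0 := Units.ne_zero _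
  have hA : HeckeCharacter.archFactor p q (globalToInfiniteUnits K k) ≠ 0 := by
    intro h0; rw [h0, zero_mul] at h5; exact zero_ne_one h5
  have key : ((heckeOfGross h𝔣 hψ (localUnits w u) : ℂˣ) : ℂ)⁻¹ =
      LFunctions.idealPow K ψ (Ideal.span {a}) * HeckeCharacter.archFactor p q (globalToInfiniteUnits K k) := by
    rw [← h4, ← h2, h1, Units.val_inv_eq_inv_val]
  have hkK : ((k : Kˣ) : K) = (a : K) := by rw [hk, Units.val_mk0]
  rw [hkK] at h5
  calc ((heckeOfGross h𝔣 hψ (localUnits w u) : ℂˣ) : ℂ) * LFunctions.idealPow K ψ (Ideal.span {a})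
      = ((heckeOfGross h𝔣 hψ (localUnits w u) : ℂˣ) : ℂ) *
          (LFunctions.idealPow K ψ (Ideal.span {a}) * HeckeCharacter.archFactor p q (globalToInfiniteUnits K k)) *
          (HeckeCharacter.archFactor p q (globalToInfiniteUnits K k))⁻¹ := by
        field_simp
    _ = (HeckeCharacter.archFactor p q (globalToInfiniteUnits K k))⁻¹ := by rw [← key, mul_inv_cancel₀ hX, one_mul]
    _ = ∏ w' : InfinitePlace K, w'.embedding (a : K) ^ p w' * conj (w'.embedding (a : K)) ^ q w' :=
        (eq_inv_of_mul_eq_one_right h5).symm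

/-- **Ramification criterion for `heckeOfGross`**: under the hypotheses of `heckeOfGross_localUnits_mul_idealPow`, if
`χ̃((a)) ≠ ∏_{w'} σ_{w'}(a)^{p} σ̄_{w'}(a)^{q}` then `ω` is RAMIFIED at `w` (`⟨a⟩_w` is a local unit on which `ω ≠ 1`).
[cite: CasselsFrohlichANT1967, Ch. VII §4 Prop. 4.1] [cite: NeukirchANT1999, Ch. VII §6 Prop. (6.13)] -/
theorem not_isUnramifiedAt_heckeOfGross_of_ne [IsTotallyComplex K] (h𝔣 : 𝔣 ≠ ⊥) (hψ : IsGrossencharakter 𝔣 p q ψ)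
    {w : HeightOneSpectrum (𝓞 K)} (hw : 𝔣 ≤ w.asIdeal) {a : 𝓞 K} (haw : a ∉ w.asIdeal)
    (hcop : IsCoprime (Ideal.span {a}) 𝔣)
    (hcong : ∀ v : HeightOneSpectrum (𝓞 K), v ≠ w → modulusExp 𝔣 v ≠ 0 → a - 1 ∈ v.asIdeal ^ modulusExp 𝔣 v)
    (hne : LFunctions.idealPow K ψ (Ideal.span {a}) ≠
      ∏ w' : InfinitePlace K, w'.embedding (a : K) ^ p w' * conj (w'.embedding (a : K)) ^ q w') :
    ¬ (heckeOfGross h𝔣 hψ).IsUnramifiedAt w := by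
  have hval : Valued.v (algebraMap K (w.adicCompletion K) (a : K)) = 1 := by
    rw [valued_algebraMap_adicCompletion, show (a : K) = algebraMap (𝓞 K) K a from rfl, valuation_of_algebraMap]
    exact le_antisymm (intValuation_le_one w a) (not_lt.mp fun h => haw ((intValuation_lt_one_iff_mem w a).mp h))
  have haw' : algebraMap K (w.adicCompletion K) (a : K) ≠ 0 := fun h => by
    rw [h, map_zero] at hval; exact zero_ne_one hval
  intro hunr
  rw [HeckeCharacter.isUnramifiedAt_iff_forall_valued_eq_one] at hunr
  have h1 := hunr (Units.mk0 _ haw') (by rw [Units.val_mk0]; exact hval)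
  have h2 := heckeOfGross_localUnits_mul_idealPow h𝔣 hψ hw hcop hcong haw'
  rw [heckeOfGross_apply] at h1
  rw [show ((heckeOfGross h𝔣 hψ (localUnits w (Units.mk0 _ haw')) : ℂˣ) : ℂ) = 1 by
    rw [heckeOfGross_apply, h1, Units.val_one], one_mul] at h2
  exact hne h2

variable [IsPrincipalIdealRing (𝓞 K)]

/-- **Ramification of the character `(α) ↦ e(α) ε(ᾱ)⁻¹` at a prime of the modulus**: with `e`, `ε`, `𝔣` as in
`isGrossencharakter_charGenValue` over a totally complex `K`, a prime `𝔭_w ⊇ 𝔣` and an integer `a ∉ 𝔭_w`, prime to `𝔣`,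
`≡ 1` modulo the other prime-power factors of `𝔣`, with `ε(ā) ≠ 1`: the Hecke character `heckeOfGross` is ramified at
`w` (its value on the local unit `⟨a⟩_w` is `ε(ā) ≠ 1`). For `𝔣` a prime power this is just "`ε` is non-trivial".
[cite: IrelandRosen1982, Ch. 18 §7] [cite: NeukirchANT1999, Ch. VII §6 Prop. (6.13)] -/
theorem not_isUnramifiedAt_heckeOfGross_charGenValue [IsTotallyComplex K] (h𝔣 : 𝔣 ≠ ⊥) (e : K →+* ℂ)
    (ε : MulChar (𝓞 K ⧸ 𝔣) ℂ) (hε : ∀ u : (𝓞 K)ˣ, ε (Ideal.Quotient.mk 𝔣 u) = e ((u : 𝓞 K) : K))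
    {w : HeightOneSpectrum (𝓞 K)} (hw : 𝔣 ≤ w.asIdeal) {a : 𝓞 K} (haw : a ∉ w.asIdeal)
    (hcop : IsCoprime (Ideal.span {a}) 𝔣)
    (hcong : ∀ v : HeightOneSpectrum (𝓞 K), v ≠ w → modulusExp 𝔣 v ≠ 0 → a - 1 ∈ v.asIdeal ^ modulusExp 𝔣 v)
    (hεa : ε (Ideal.Quotient.mk 𝔣 a) ≠ 1) :
    ¬ (heckeOfGross h𝔣 (isGrossencharakter_charGenValue e ε hε)).IsUnramifiedAt w := by
  have ha0 : a ≠ 0 := fun h => haw (by rw [h]; exact zero_mem _)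
  refine not_isUnramifiedAt_heckeOfGross_of_ne h𝔣 _ hw haw hcop hcong ?_
  rw [idealPow_charGenValue_span e ε hε ha0, prod_embedding_zpow_embType, charNormValue_apply]
  have he0 : e (a : K) ≠ 0 := (map_ne_zero e).mpr (by exact_mod_cast ha0)
  have hε0 : ε (Ideal.Quotient.mk 𝔣 a) ≠ 0 := by
    obtain ⟨u, hu⟩ := isUnit_mk_of_isCoprime_span hcop
    rw [← hu, ← MulChar.coe_toUnitHom]
    exact Units.ne_zero _
  intro h
  apply hεa
  field_simp at h
  linear_combination -h

end LocalUnits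

end Literature.NumberTheory.GaloisRepresentations
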